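import Literature.MathematicalPhysics.QuantumFieldTheory.Balaban1983to89.B9CoRealizesRel
import Literature.MathematicalPhysics.QuantumFieldTheory.Balaban1983to89.B9Ineq347GAAtLetters
import Literature.MathematicalPhysics.QuantumFieldTheory.Balaban1983to89.B9IndexBondAtLevel

/-!
# `Balaban1983to89.B9CoRealizesRelAtLetters` — the repaired (3.42) co-reading `CoRealizesRel` at the CARRIER-BLOCK EQUIVALENCE IS INHABITED at def-Y's
# bond-sector readings: saturation of `maj342` at `geo9K`, a carrier-faithful block map, dischargeability by domination, and G(1) outright at U = 1

T. Bałaban, *Propagators for lattice gauge theories in a background field*, Commun. Math. Phys. **99** (1985) 389–434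
[`Balaban1985BackgroundPropagators`, "B9"]; [4] = T. Bałaban, *Propagators and renormalization transformations for lattice gauge
theories. II*, Commun. Math. Phys. **96** (1984) 223–250 [`Balaban1984PropagatorsII`].

statement-level skeleton of published theorems with citation tags; proofs where landed; nothing here is a claim about the
Yang–Mills mass gap

THE PRINTED LOCI.  (3.42) p. 397 (*"for x ∈ Δ(y), y ∈ Λ_j, supp λ ⊂ Δ(y′)"* — y, y′ BLOCKS of 𝔅); Cor. 3.5 p. 407 (U = 1 is [4]); [4] (2.22) p. 226, p. 228.

THE POINT (companion of `B9CoRealizesSharedBlock` and `B9CoRealizesRel`).  At the geometry of record the old co-reading `CoRealizes (….GA) 0 1 …` is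
UNSATISFIABLE (`not_hcoGA_opsYOfRecord`); the repaired one, relative to the carrier-block equivalence `RelB i c c′ :↔ β c = β c′`, IS SATISFIED:
* §1 `RelB`, its decidability-free API, and the SATURATION of the (3.42) majorant at `geo9K`: `maj342 (geo9K i) n B δ` depends on an index bond only
  through its carrier block (`len` by `beta_level`, `dist` by definition) — `maj342_relB_left`, `maj342_relB_right`.
* §2 `exists_carrierFaithful` — a block map `bI : fine bonds → index bonds` with `β (bI x) = block of x` for every fine bond OF A CARRIER BLOCK exists (by
  choice; on orphan blocks any index bond of the right level, `B9IndexBondAtLevel.exists_bondIdx_lvl_eq`).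
* §3 ★ `coRealizesRel_zero_kernelFamilyB` — for ANY bond-sector letter O, any U₁: `CoRealizesRel (kernelFamilyB i B cfg O par) 0 U₁ (RelB i) bI bI ev A`
  from (i) `bI` carrier-faithful on carrier blocks, (ii) `ev (.inr J) = J`, `ev (.inl f) = 0`, (iii) domination ‖(O(cfg U₁)(J ⊗ E))(x)‖ ≦ |(AJ)(x)| on the
  unit ball — `off` holds because a fine bond where J ≠ 0 lies in the block `β y′` hence `β (bI x′) = β y′`; `obs` reads the whole carrier block.
* §4 ★★ `exists_coRealizesRel_zero_GA_one` — at U = 1, for G, NOTHING is left: by `GA_one` the model `A := Gop = Δ_a⁻¹` dominates, so at EVERY member and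
  for EVERY letter record `∃ bI ev, CoRealizesRel ((operatorLayerYOfLetters 𝔸 G x 𝔏 𝔈).GA) 0 1 (RelB x.toKIdx) bI bI ev (Gop x.toKIdx)` — CONTRAST
  `B9CoRealizesSharedBlock.not_hcoGA_opsYOfLetters` for `CoRealizes`.
The multiplicity of a carrier class (≦ 2(d+1) index bonds per block, the `m` of `clause342_of_hasMajorantHom_rel`) is not counted here.

HONEST SCOPE.  Dischargeability bookkeeping at the record's carriers; nothing of [B9] asserted; the domination at general U stays the instance seat's
obligation; count-neutral; N06 NOT discharged; nothing continuum, nothing about the mass gap.  Cell `pub-ymgap` (HUMAN RULING D-0062), Track A node N06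
[B9], seat `pub-ymgap-dag-n06-l` (g3), 2026-08-27.
-/

noncomputable section

namespace Literature.MathematicalPhysics.QuantumFieldTheory.Balaban1983to89.B9CoRealizesRelAtLetters

open B6SectAOperatorsV1 (BondIdx)
open B6GlobalChartV1 (PV domT blkV1)
open B6Ineq2142KLevelV1 (β lvl beta_level)
open B6KLevelCensusIndexV1 (KIdx abs_le_supNormG)
open B6Prop26Census2136KLevelV1 (Gop)
open B9SectCDiffDict (maj342)
open B9GeoNormsKLevelV1 (geo9K geo9K_supNorm_nonneg)
open B9CoRealizesRel (CoRealizesRel)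
open B9IndexBondAtLevel (exists_bondIdx_lvl_eq)
open B9PinMembersKLevelV1 (MemberY geo9Y bg9Y)
open Node00 (SiteY FBondY BlkY IBondY CfgY BallY liftY norm_liftY_le supInB kernelFamilyB BondOpY BondParY CovLettersY ExpLettersY
  operatorLayerYOfLetters iSup_ball_le)

variable {d ℓ : ℕ} {hd : 1 ≤ d + 1} {hL : Odd (ℓ + 1) ∧ 1 < ℓ + 1} {b₀ b₁ : ℝ}
variable {𝔸 : Type} [NormedRing 𝔸] [NormedAlgebra ℂ 𝔸] [CompleteSpace 𝔸]

/-! ## §1 The carrier-block equivalence on the index bonds and the saturation of `maj342` -/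

section Rel

variable (i : KIdx d ℓ hd hL b₀ b₁)

/-- **the carrier-block equivalence** on the index bonds of a member: `c ∼ c′ :↔ β c = β c′` (print's y ∈ 𝔅 read as the class of its index bonds).
[cite: Balaban1984PropagatorsII, (2.45) p.231 + (2.3) p.224, dictionary] -/
def RelB (c c' : IBondY i) : Prop := β i.hN i.D i.hk c = β i.hN i.D i.hk c'

/-- `RelB` is reflexive. [cite: Balaban1984PropagatorsII, (2.45) p.231, bookkeeping] -/
theorem relB_refl (c : IBondY i) : RelB i c c := rfl

/-- equivalent index bonds have the same scale length (same level, `beta_level`). [cite: Balaban1984PropagatorsII, (2.45) p.231, bookkeeping] -/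
theorem len_eq_of_relB {c c' : IBondY i} (h : RelB i c c') : (geo9K i).len c = (geo9K i).len c' := by
  have hk1 : 1 ≤ i.k := le_trans one_le_two i.hk2
  show (((ℓ + 1 : ℕ) : ℝ)) ^ (lvl i.hN i.D i.hk c) * |i.cf|⁻¹ = (((ℓ + 1 : ℕ) : ℝ)) ^ (lvl i.hN i.D i.hk c') * |i.cf|⁻¹
  rw [← beta_level i.hN i.D i.hk hk1 c, ← beta_level i.hN i.D i.hk hk1 c', show β i.hN i.D i.hk c = β i.hN i.D i.hk c' from h]

/-- the distance of index bonds is the torus distance of their carrier blocks (definition of the record's geometry). [cite: Balaban1984PropagatorsII, (2.46) p.231, dictionary] -/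
theorem dist_eq_of_relB {a a' b b' : IBondY i} (ha : RelB i a a') (hb : RelB i b b') : (geo9K i).dist a b = (geo9K i).dist a' b' := by
  show (B6Geom246MultiLevelTorus.geomT i.D).dist (β i.hN i.D i.hk a) (β i.hN i.D i.hk b) =
    (B6Geom246MultiLevelTorus.geomT i.D).dist (β i.hN i.D i.hk a') (β i.hN i.D i.hk b')
  rw [show β i.hN i.D i.hk a = β i.hN i.D i.hk a' from ha, show β i.hN i.D i.hk b = β i.hN i.D i.hk b' from hb]

/-- **`maj342` at `geo9K` is saturated in the first argument.** [cite: Balaban1985BackgroundPropagators, (3.42) p.397 (y ∈ 𝔅 a block), bookkeeping] -/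
theorem maj342_relB_left (n : Fin 4) (B δ : ℝ) (a a' b : IBondY i) (h : RelB i a a') :
    maj342 (geo9K i) n B δ a b = maj342 (geo9K i) n B δ a' b := by
  simp only [maj342]
  rw [len_eq_of_relB i h, dist_eq_of_relB i h (relB_refl i b)]

/-- **`maj342` at `geo9K` is saturated in the second argument.** [cite: Balaban1985BackgroundPropagators, (3.42) p.397 (y′ ∈ 𝔅 a block), bookkeeping] -/
theorem maj342_relB_right (n : Fin 4) (B δ : ℝ) (a b b' : IBondY i) (h : RelB i b b') :
    maj342 (geo9K i) n B δ a b = maj342 (geo9K i) n B δ a b' := by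
  simp only [maj342]
  rw [dist_eq_of_relB i (relB_refl i a) h]

end Rel

/-! ## §2 A block map carrier-faithful on the carrier blocks exists -/

section Faithful

variable (i : KIdx d ℓ hd hL b₀ b₁)

/-- **A BLOCK MAP CARRIER-FAITHFUL ON CARRIER BLOCKS EXISTS** (by choice): `bI x` is an index bond of the block of x whenever that block carries one;
elsewhere (orphan blocks) any index bond (`exists_bondIdx_lvl_eq` supplies one). [cite: Balaban1984PropagatorsII, (2.45) p.231 + (2.3) p.224, bookkeeping] -/
theorem exists_carrierFaithful :
    ∃ bI : FBondY i → IBondY i, ∀ (x : FBondY i) (c : IBondY i), blkV1 i.hN i.D x = β i.hN i.D i.hk c → β i.hN i.D i.hk (bI x) = blkV1 i.hN i.D x := by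
  classical
  refine ⟨fun x => if h : ∃ c : IBondY i, β i.hN i.D i.hk c = blkV1 i.hN i.D x then h.choose else (exists_bondIdx_lvl_eq i.hN i.D i.hk x).choose,
    fun x c hxc => ?_⟩
  have h : ∃ c : IBondY i, β i.hN i.D i.hk c = blkV1 i.hN i.D x := ⟨c, hxc.symm⟩
  simp only [h, dif_pos]
  exact h.choose_spec

end Faithful

/-! ## §3 ★ The repaired co-reading, entry 0, at any bond-sector letter: dischargeable by domination -/

section BondLetter

variable (i : KIdx d ℓ hd hL b₀ b₁) (B : B9.Backgrounds) (cfg : B.Cfg → CfgY 𝔸 i) (O : BondOpY 𝔸 i) (par : BondParY 𝔸 i) (U₁ : B.Cfg)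

/-- ★ **`CoRealizesRel … 0 U₁ (RelB i) bI bI ev A` HOLDS AT def-Y's READING OF ANY BOND-SECTOR LETTER** given (i) a block map carrier-faithful on carrier
blocks, (ii) the evaluation of sum-typed arguments (`.inr J ↦ J`, `.inl f ↦ 0`), (iii) domination of the letter by the real model operator on product-form
arguments at `U₁`.  `off`: a fine bond where J ≠ 0 lies in `β y′`, so its image is in the class of y′; `obs`: the class of y contains the images of ALL fine
bonds of `β y`, which are exactly what the reading `supInB (β y)` reads. [cite: Balaban1985BackgroundPropagators, (3.42) p.397 + (3.39) p.397] -/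
theorem coRealizesRel_zero_kernelFamilyB {bI : FBondY i → IBondY i}
    (hβI : ∀ (x : FBondY i) (c : IBondY i), blkV1 i.hN i.D x = β i.hN i.D i.hk c → β i.hN i.D i.hk (bI x) = blkV1 i.hN i.D x)
    {ev : (geo9K i).Loc → FBondY i → ℝ} (hev_inr : ∀ (J : FBondY i → ℝ) (x : FBondY i), ev (Sum.inr J) x = J x)
    (hev_inl : ∀ (f : SiteY i → ℝ) (x : FBondY i), ev (Sum.inl f) x = 0)
    {A : (FBondY i → ℝ) →ₗ[ℝ] (FBondY i → ℝ)}
    (hdom : ∀ (J : FBondY i → ℝ) (E : BallY 𝔸) (x : FBondY i), ‖O (cfg U₁) (liftY J (E : 𝔸)) x‖ ≤ |A J x|) :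
    CoRealizesRel (kernelFamilyB i B cfg O par) 0 U₁ (RelB i) bI bI ev A := by
  classical
  refine ⟨?_, ?_, fun lam => geo9K_supNorm_nonneg i lam, ?_⟩
  · -- off
    intro lam y' hs x' hrel
    cases lam with
    | inl f => exact hev_inl f x'
    | inr J =>
        rw [hev_inr]
        by_contra hJ
        have hx' : blkV1 i.hN i.D x' = β i.hN i.D i.hk y' := hs x' hJ
        exact hrel ((hβI x' y' hx').trans hx')
  · -- bound
    intro lam x'
    cases lam with
    | inl f => rw [hev_inl, abs_zero]; exact geo9K_supNorm_nonneg i _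
    | inr J => rw [hev_inr]; exact abs_le_supNormG i J x'
  · -- obs
    intro lam y c hc hx
    cases lam with
    | inl f => exact hc
    | inr J =>
        have hJ : ev (Sum.inr J) = J := funext (hev_inr J)
        rw [hJ] at hx
        show (⨆ E : BallY 𝔸, ((![supInB i (β i.hN i.D i.hk y) (O (cfg U₁) (liftY J (E : 𝔸))),
            ⨆ ν : Fin (d + 1), supInB i (β i.hN i.D i.hk y) (Node00.cdB i (cfg U₁) ν (O (cfg U₁) (liftY J (E : 𝔸)))),
            ⨆ ν : Fin (d + 1), supInB i (β i.hN i.D i.hk y) (O (cfg U₁) (Node00.cdsB i (cfg U₁) ν (liftY J (E : 𝔸)))),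
            supInB i (β i.hN i.D i.hk y) (Node00.lapB i (cfg U₁) (O (cfg U₁) (liftY J (E : 𝔸))))] : Fin 4 → ℝ) 0)) ≤ c
        refine iSup_ball_le (fun E => ?_) hc
        simp only [Matrix.cons_val_zero]
        unfold supInB
        refine Real.iSup_le (fun b => (hdom J E b.1).trans (hx b.1 ?_)) hc
        exact (hβI b.1 y b.2).trans b.2

end BondLetter

/-! ## §4 ★★ G(1) at a member: the repaired co-reading holds OUTRIGHT (contrast `not_hcoGA_opsYOfLetters`) -/

section AtOne

variable {Mstar : ℕ} {G : Subgroup 𝔸ˣ} (x : MemberY d ℓ hd hL b₀ b₁ Mstar) (𝔏 : CovLettersY 𝔸 x) (𝔈 : ExpLettersY 𝔸 G x)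

/-- ★★ **AT EVERY MEMBER, FOR EVERY LETTER RECORD, THE REPAIRED (3.42) CO-READING OF G(1) IS SATISFIED**: a carrier-faithful block map (§2), the evaluation
`(.inr J ↦ J, .inl f ↦ 0)`, the model `Gop = Δ_a⁻¹` (domination by `GA_one`, ‖E‖ ≦ 1) give `CoRealizesRel ((operatorLayerYOfLetters 𝔸 G x 𝔏 𝔈).GA) 0 1
(RelB x.toKIdx) bI bI ev (Gop x.toKIdx)` — whereas `CoRealizes` of the same reading is refutable (`B9CoRealizesSharedBlock`).
[cite: Balaban1985BackgroundPropagators, (3.42) p.397 + Cor. 3.5 p.407; Balaban1984PropagatorsII, (2.22) p.226] -/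
theorem exists_coRealizesRel_zero_GA_one :
    ∃ (bI : FBondY x.toKIdx → IBondY x.toKIdx) (ev : (geo9K x.toKIdx).Loc → FBondY x.toKIdx → ℝ),
      CoRealizesRel (operatorLayerYOfLetters 𝔸 G x 𝔏 𝔈).GA 0 (bg9Y 𝔸 G x).one (RelB x.toKIdx) bI bI ev (Gop x.toKIdx) := by
  obtain ⟨bI, hbI⟩ := exists_carrierFaithful x.toKIdx
  refine ⟨bI, fun lam b => Sum.elim (fun _ => (0 : ℝ)) (fun J => J b) lam, ?_⟩
  refine coRealizesRel_zero_kernelFamilyB x.toKIdx (bg9Y 𝔸 G x) (fun U => U) 𝔏.GA 𝔏.parB _ hbI (fun _ _ => rfl) (fun _ _ => rfl) ?_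
  intro J E b
  change ‖𝔏.GA (fun _ _ => 1) (liftY J (E : 𝔸)) b‖ ≤ _
  rw [𝔏.GA_one]
  exact norm_liftY_le _ E b

end AtOne

end Literature.MathematicalPhysics.QuantumFieldTheory.Balaban1983to89.B9CoRealizesRelAtLetters

end
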